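import Literature.NumberTheory.Automorphic.QuaternionOrderHeckeJacquetLanglands
import HarnessLib

/-!
# The Hecke operator `T_n` of an arbitrary quaternion order preserves weight-two cusp forms

Topic `NumberTheory/Automorphic`. THEOREMS ONLY (no definition, no named fact, no `sorry`). For ANY order `O` of a `ℚ`-algebra `B`
with a real splitting `ι : B → M₂(ℝ)`, `Γ = ι(O¹) = normOneUnits ι hO`, and any `n` for which the coset space `Γ∖ι(O(n))` is finite, the
function-level Hecke operator `unitsHeckeFun ι hO n` of `QuaternionOrderHeckeJacquetLanglands.lean` (`T_n h = Σ_{Γ∖ι(O(n))} h ∣[2] g`)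
maps `S₂(Γ)` to `S₂(Γ)`: `exists_cuspForm_coe_eq_unitsHeckeFun`, and is induced by a (unique) `ℂ`-linear endomorphism of `CuspForm Γ 2`:
`exists_linearMap_coe_eq_unitsHeckeFun`, `linearMap_coe_eq_unitsHeckeFun_unique`; an eigen-identity of functions `T_n F = a·F` is an
eigen-identity in `S₂(Γ)`: `linearMap_apply_eq_smul_of_unitsHeckeFun_eq`. This is Shimura's Prop. 3.37 («`[Γ₁ α Γ₂]_k` sends `S_k(Γ₁)` into
`S_k(Γ₂)`») for `Γ₁ = Γ₂ = ι(O¹)` and the double cosets in `ι(O(n))`, written for the tree's `finsum` operator; the tree had it only for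
Eichler level and `D > 1` (`ShimuraCurveData.exists_cuspForm_coe_eq_heckeFun`, where the cusp condition is vacuous). The one new ingredient
is the CUSP CONDITION for `D = 1` (`isZeroAt_unitsHeckeFun`): for `α ∈ ι(O(n))` and a cusp `c` of `Γ`, `α • c` is again a cusp of `Γ`
(`isCusp_smul_of_mem_unitsHeckeSet`), because `Γ ∩ α⁻¹Γα` has finite index in `Γ` — its cosets inject into the finite coset space
`Γ∖ι(O(n))` (`relIndex_inf_conj_ne_zero`; Shimura Prop. 3.1: `Γ α Γ = ⊔ Γ α γ_i` with `Γ = ⊔ (Γ ∩ α⁻¹Γα) γ_i`) — so a power of the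
conjugated parabolic lies in `Γ` (Mathlib `isCusp_iff_of_relIndex_ne_zero`). Invariance and holomorphy are VERBATIM the Eichler-level
proofs (`ShimuraCurveData.heckeFun_slash_eq`, `mdifferentiable_heckeFun`) with the order as a parameter and the finiteness of the coset
space as a hypothesis instead of `D > 1` (supplied from a finite complete system of representatives by
`finite_quotient_unitsHeckeSetoid_of_cover`).

Filed by the BSD cell `bsd-stepL` (seat `defn-ty1` g43, literature-prover) for the kernel of (LIFT′)
`Summit.…Theorems.CartanCarayol.CuspidalEigenCochainLiftPrimeToCartanPlaceAtThree` (crux `CartanOnePlaceDegreeLawAtThree`, item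
stmt-BirchSwinnertonDyer-24801): with `Γ' = coverUnits X q = normOneUnits X.ι (isOrder_coverOrder X q)` and the finiteness of `Γ'∖ι(O₀'(ℓ))`
supplied by the representatives of (SIMREP), it gives the Hecke operators `T_ℓ ∈ End_ℂ S₂(Γ')` on which (ESᶜ) `eichlerShimura_weightTwo_rePeriod`,
(COMMᶜ) `unitsHeckeFun_comm_cartanCover` and (JLᶜ) `jacquetLanglands_cartanCover_newform` are read. Nothing here is specific to a curve; BSD is
proved for no curve.

## References
* [ShimuraIATAF1971] Prop. 3.37 p. 76 ✓ (`[Γ₁αΓ₂]_k : S_k(Γ₁) → S_k(Γ₂)`), Prop. 3.1 p. 51 ✓ (coset decomposition of `ΓαΓ`), §8.3 (8.3.4) p. 238 ✓.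
-/

noncomputable section

open scoped MatrixGroups ModularForm Manifold Pointwise
open UpperHalfPlane hiding I

namespace Literature.NumberTheory.Automorphic

section UnitsHeckeCuspForm

variable {B : Type*} [Ring B] [Algebra ℚ B] (ιB : B →ₐ[ℚ] Matrix (Fin 2) (Fin 2) ℝ) {O : Submodule ℤ B}
  (hO : Brandt.IsOrder B O)

/-! ### 1. `T_n` as a finite sum -/

/-- With a `Fintype` structure on `Γ∖ι(O(n))`, `T_n h = ∑_q h ∣[2] q.out` as functions on `ℍ` (as `ShimuraCurveData.heckeFun_eq_sum`).
[cite: ShimuraIATAF1971, §8.3 (8.3.4) p. 238] -/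
theorem unitsHeckeFun_eq_sum (n : ℕ) [Fintype (Quotient (unitsHeckeSetoid ιB hO n))] (h : ℍ → ℂ) :
    unitsHeckeFun ιB hO n h =
      ∑ q : Quotient (unitsHeckeSetoid ιB hO n), (h ∣[(2 : ℤ)] ((q.out : unitsHeckeSet ιB (O := O) n) : GL (Fin 2) ℝ)) := by
  funext τ
  simp only [unitsHeckeFun, finsum_eq_sum_of_fintype, Finset.sum_apply]

/-! ### 2. `Γ`-invariance and holomorphy (verbatim the Eichler-level proofs, order as a parameter) -/

/-- **`Γ`-invariance of `T_n h`**: if `h ∣[2] δ = h` for all `δ ∈ Γ = ι(O¹)` then `(T_n h) ∣[2] γ = T_n h` for `γ ∈ Γ` (finite coset space).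
Right multiplication by `γ` permutes `Γ∖ι(O(n))`; the representative of the image coset differs from `q.out γ` by an element of `Γ` on the
left, which `h` absorbs (as `ShimuraCurveData.heckeFun_slash_eq`). [cite: ShimuraIATAF1971, §3.3 and Prop. 3.37 p. 76] -/
theorem unitsHeckeFun_slash_eq (n : ℕ) [Fintype (Quotient (unitsHeckeSetoid ιB hO n))] {γ : GL (Fin 2) ℝ}
    (hγ : γ ∈ normOneUnits ιB hO) (h : ℍ → ℂ) (hh : ∀ δ ∈ normOneUnits ιB hO, h ∣[(2 : ℤ)] δ = h) :
    (unitsHeckeFun ιB hO n h) ∣[(2 : ℤ)] γ = unitsHeckeFun ιB hO n h := by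
  classical
  -- right translations by `γ` and `γ⁻¹` on `ι(O(n))` and on the coset space
  let ρ : unitsHeckeSet ιB (O := O) n → unitsHeckeSet ιB (O := O) n :=
    fun a => ⟨a * γ, unitsHeckeSet_mul_mem ιB hO a.2 hγ⟩
  let ρ' : unitsHeckeSet ιB (O := O) n → unitsHeckeSet ιB (O := O) n :=
    fun a => ⟨a * γ⁻¹, unitsHeckeSet_mul_mem ιB hO a.2 (inv_mem hγ)⟩
  have hρ : ∀ a b : unitsHeckeSet ιB (O := O) n,
      (unitsHeckeSetoid ιB hO n) a b → (unitsHeckeSetoid ιB hO n) (ρ a) (ρ b) := by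
    rintro a b ⟨δ, hδ, hab⟩
    exact ⟨δ, hδ, by simp only [ρ, ← mul_assoc, hab]⟩
  have hρ' : ∀ a b : unitsHeckeSet ιB (O := O) n,
      (unitsHeckeSetoid ιB hO n) a b → (unitsHeckeSetoid ιB hO n) (ρ' a) (ρ' b) := by
    rintro a b ⟨δ, hδ, hab⟩
    exact ⟨δ, hδ, by simp only [ρ', ← mul_assoc, hab]⟩
  let e : Quotient (unitsHeckeSetoid ιB hO n) ≃ Quotient (unitsHeckeSetoid ιB hO n) :=
    { toFun := Quotient.map ρ hρ
      invFun := Quotient.map ρ' hρ'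
      left_inv := fun q => Quotient.inductionOn q fun a => by
        simp only [Quotient.map_mk]
        refine congrArg _ (Subtype.ext ?_)
        simp only [ρ, ρ', mul_inv_cancel_right]
      right_inv := fun q => Quotient.inductionOn q fun a => by
        simp only [Quotient.map_mk]
        refine congrArg _ (Subtype.ext ?_)
        simp only [ρ, ρ', inv_mul_cancel_right] }
  have he : ∀ q, e q = Quotient.map ρ hρ q := fun q => rfl
  have hterm : ∀ q : Quotient (unitsHeckeSetoid ιB hO n),
      (h ∣[(2 : ℤ)] ((q.out : unitsHeckeSet ιB (O := O) n) : GL (Fin 2) ℝ)) ∣[(2 : ℤ)] γ =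
        h ∣[(2 : ℤ)] (((e q).out : unitsHeckeSet ιB (O := O) n) : GL (Fin 2) ℝ) := by
    intro q
    rw [← SlashAction.slash_mul]
    have h1 : e q = Quotient.mk _ (ρ q.out) := by
      conv_lhs => rw [he, ← Quotient.out_eq q]
      rfl
    have h2 : (unitsHeckeSetoid ιB hO n) (e q).out (ρ q.out) :=
      Quotient.exact (((e q).out_eq).trans h1)
    obtain ⟨δ, hδ, hδeq⟩ := h2
    have h3 : ((q.out : unitsHeckeSet ιB (O := O) n) : GL (Fin 2) ℝ) * γ =
        δ * (((e q).out : unitsHeckeSet ιB (O := O) n) : GL (Fin 2) ℝ) := hδeq.symm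
    rw [h3, SlashAction.slash_mul, hh δ hδ]
  rw [unitsHeckeFun_eq_sum, SlashAction.sum_slash]
  simp_rw [hterm]
  exact Equiv.sum_comp e (fun q => h ∣[(2 : ℤ)] ((q.out : unitsHeckeSet ιB (O := O) n) : GL (Fin 2) ℝ))

/-- **`T_n h` is holomorphic** for holomorphic `h`: a finite sum of slashes (Mathlib `MDifferentiable.slash`; as
`ShimuraCurveData.mdifferentiable_heckeFun`). [cite: ShimuraIATAF1971, Prop. 3.37 p. 76] -/
theorem mdifferentiable_unitsHeckeFun (n : ℕ) [Fintype (Quotient (unitsHeckeSetoid ιB hO n))] {h : ℍ → ℂ}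
    (hh : MDifferentiable 𝓘(ℂ) 𝓘(ℂ) h) : MDifferentiable 𝓘(ℂ) 𝓘(ℂ) (unitsHeckeFun ιB hO n h) := by
  rw [unitsHeckeFun_eq_sum]
  exact MDifferentiable.sum fun q _ => hh.slash 2 _

/-- `T_n (h₁ + h₂) = T_n h₁ + T_n h₂` (finite coset space). [cite: ShimuraIATAF1971, §8.3 (8.3.4) p. 238] -/
theorem unitsHeckeFun_add (n : ℕ) [Fintype (Quotient (unitsHeckeSetoid ιB hO n))] (h₁ h₂ : ℍ → ℂ) :
    unitsHeckeFun ιB hO n (h₁ + h₂) = unitsHeckeFun ιB hO n h₁ + unitsHeckeFun ιB hO n h₂ := by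
  simp only [unitsHeckeFun_eq_sum, SlashAction.add_slash, Finset.sum_add_distrib]

/-- Elements of `ι(O(n))` have positive determinant (`det = n`, non-zero in `GL₂(ℝ)`). [cite: ShimuraIATAF1971, §3.3] -/
theorem det_pos_of_mem_unitsHeckeSet {n : ℕ} {a : GL (Fin 2) ℝ} (ha : a ∈ unitsHeckeSet ιB (O := O) n) :
    0 < a.det.val := by
  have h1 : a.det.val = (n : ℝ) := by rw [Matrix.GeneralLinearGroup.val_det_apply]; exact ha.2
  have h2 : a.det.val ≠ 0 := a.det.ne_zero
  rw [h1] at h2 ⊢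
  exact lt_of_le_of_ne (Nat.cast_nonneg n) (Ne.symm h2)

/-- `(c • h) ∣[2] a = c • (h ∣[2] a)` for `a ∈ ι(O(n))` (positive determinant: Mathlib's twist `σ_a` is the identity).
[cite: ShimuraIATAF1971, §8.3 (8.3.4) p. 238] -/
private theorem smul_slash_of_mem {n : ℕ} {a : GL (Fin 2) ℝ} (ha : a ∈ unitsHeckeSet ιB (O := O) n)
    (c : ℂ) (h : ℍ → ℂ) : (c • h) ∣[(2 : ℤ)] a = c • (h ∣[(2 : ℤ)] a) := by
  rw [ModularForm.smul_slash]
  congr 1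
  rw [σ, if_pos (det_pos_of_mem_unitsHeckeSet ιB ha)]
  rfl

/-- `T_n (a • h) = a • T_n h` (finite coset space). [cite: ShimuraIATAF1971, §8.3 (8.3.4) p. 238] -/
theorem unitsHeckeFun_smul (n : ℕ) [Fintype (Quotient (unitsHeckeSetoid ιB hO n))] (a : ℂ) (h : ℍ → ℂ) :
    unitsHeckeFun ιB hO n (a • h) = a • unitsHeckeFun ιB hO n h := by
  rw [unitsHeckeFun_eq_sum, unitsHeckeFun_eq_sum, Finset.smul_sum]
  exact Finset.sum_congr rfl fun q _ => smul_slash_of_mem ιB (q.out).2 a h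

/-! ### 3. Cusps: `Γ ∩ α⁻¹Γα` has finite index in `Γ`, so `α` maps cusps of `Γ` to cusps of `Γ` -/

/-- **`[Γ : Γ ∩ α⁻¹Γα] < ∞` for `α ∈ ι(O(n))` when `Γ∖ι(O(n))` is finite**: the cosets `γ(Γ ∩ α⁻¹Γα)` inject into `Γ∖ι(O(n))` by
`γ ↦ Γαγ⁻¹` (Shimura Prop. 3.1: `ΓαΓ = ⊔_i Γαγ_i` with `Γ = ⊔_i (Γ ∩ α⁻¹Γα)γ_i`). [cite: ShimuraIATAF1971, Prop. 3.1 p. 51] -/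
theorem relIndex_inf_conj_ne_zero (n : ℕ) [Finite (Quotient (unitsHeckeSetoid ιB hO n))] {α : GL (Fin 2) ℝ}
    (hα : α ∈ unitsHeckeSet ιB (O := O) n) :
    (normOneUnits ιB hO ⊓ ConjAct.toConjAct α⁻¹ • normOneUnits ιB hO).relIndex (normOneUnits ιB hO) ≠ 0 := by
  classical
  set Γ := normOneUnits ιB hO with hΓ
  set H := Γ ⊓ ConjAct.toConjAct α⁻¹ • Γ with hH
  -- membership in the conjugate
  have hmem : ∀ x : GL (Fin 2) ℝ, x ∈ ConjAct.toConjAct α⁻¹ • Γ ↔ α * x * α⁻¹ ∈ Γ := by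
    intro x
    rw [Subgroup.mem_pointwise_smul_iff_inv_smul_mem, ← ConjAct.toConjAct_inv, inv_inv, ConjAct.toConjAct_smul]
  -- `γ ↦ Γ α γ⁻¹`
  let ψ : Γ → Quotient (unitsHeckeSetoid ιB hO n) := fun γ =>
    Quotient.mk _ ⟨α * (γ : GL (Fin 2) ℝ)⁻¹, unitsHeckeSet_mul_mem ιB hO hα (inv_mem γ.2)⟩
  have hψ : ∀ γ₁ γ₂ : Γ, ψ γ₁ = ψ γ₂ ↔ γ₁⁻¹ * γ₂ ∈ H.subgroupOf Γ := by
    intro γ₁ γ₂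
    rw [Subgroup.mem_subgroupOf, Subgroup.coe_mul, Subgroup.coe_inv, hH, Subgroup.mem_inf, hmem]
    constructor
    · intro h
      obtain ⟨δ, hδ, hδeq⟩ := Quotient.exact h
      have hδeq' : δ * (α * (γ₁ : GL (Fin 2) ℝ)⁻¹) = α * (γ₂ : GL (Fin 2) ℝ)⁻¹ := hδeq
      refine ⟨mul_mem (inv_mem γ₁.2) γ₂.2, ?_⟩
      have hδ' : δ = α * (γ₂ : GL (Fin 2) ℝ)⁻¹ * ((γ₁ : GL (Fin 2) ℝ) * α⁻¹) := by
        rw [← hδeq']; group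
      have : α * ((γ₁ : GL (Fin 2) ℝ)⁻¹ * γ₂) * α⁻¹ = δ⁻¹ := by rw [hδ']; group
      rw [this]
      exact inv_mem hδ
    · rintro ⟨-, hconj⟩
      refine Quotient.sound ⟨α * (γ₂ : GL (Fin 2) ℝ)⁻¹ * (γ₁ : GL (Fin 2) ℝ) * α⁻¹, ?_, ?_⟩
      · have : α * (γ₂ : GL (Fin 2) ℝ)⁻¹ * (γ₁ : GL (Fin 2) ℝ) * α⁻¹ = (α * ((γ₁ : GL (Fin 2) ℝ)⁻¹ * γ₂) * α⁻¹)⁻¹ := by group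
        rw [this]
        exact inv_mem hconj
      · change α * (γ₂ : GL (Fin 2) ℝ)⁻¹ * (γ₁ : GL (Fin 2) ℝ) * α⁻¹ * (α * (γ₁ : GL (Fin 2) ℝ)⁻¹) = α * (γ₂ : GL (Fin 2) ℝ)⁻¹
        group
  -- the induced injection `Γ ⧸ H ↪ Γ∖ι(O(n))`
  let f : Γ ⧸ H.subgroupOf Γ → Quotient (unitsHeckeSetoid ιB hO n) :=
    Quotient.lift ψ fun a b hab => (hψ a b).mpr (QuotientGroup.leftRel_apply.mp hab)
  have hf : Function.Injective f := by
    intro x y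
    induction x using QuotientGroup.induction_on with
    | H a =>
      induction y using QuotientGroup.induction_on with
      | H b =>
        intro hab
        exact QuotientGroup.eq.mpr ((hψ a b).mp hab)
  haveI : Finite (Γ ⧸ H.subgroupOf Γ) := Finite.of_injective f hf
  exact Subgroup.index_ne_zero_of_finite

/-- **`α • c` is a cusp of `Γ` for every cusp `c` of `Γ` and `α ∈ ι(O(n))`** (finite coset space): `c` is a cusp of the finite-index subgroup
`Γ ∩ α⁻¹Γα` (a power of the parabolic; Mathlib `isCusp_iff_of_relIndex_ne_zero`), hence of `α⁻¹Γα`, and `α` conjugates it back.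
[cite: ShimuraIATAF1971, Prop. 3.1 p. 51 and Prop. 3.37 p. 76] -/
theorem isCusp_smul_of_mem_unitsHeckeSet (n : ℕ) [Finite (Quotient (unitsHeckeSetoid ιB hO n))] {α : GL (Fin 2) ℝ}
    (hα : α ∈ unitsHeckeSet ιB (O := O) n) {c : OnePoint ℝ} (hc : IsCusp c (normOneUnits ιB hO)) :
    IsCusp (α • c) (normOneUnits ιB hO) := by
  have hrel := relIndex_inf_conj_ne_zero ιB hO n hα
  have hc' : IsCusp c (normOneUnits ιB hO ⊓ ConjAct.toConjAct α⁻¹ • normOneUnits ιB hO) :=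
    (isCusp_iff_of_relIndex_ne_zero inf_le_left hrel c).mpr hc
  have hc'' : IsCusp c (ConjAct.toConjAct α⁻¹ • normOneUnits ιB hO) := hc'.mono inf_le_right
  have h3 := hc''.smul α
  rwa [smul_smul, ← map_mul, mul_inv_cancel, map_one, one_smul] at h3

/-- The zero function vanishes at every cusp. [cite: ShimuraIATAF1971, §2.1 (cusp forms)] -/
private theorem isZeroAt_zero (c : OnePoint ℝ) (k : ℤ) : c.IsZeroAt (0 : ℍ → ℂ) k := fun g _ => by
  rw [SlashAction.zero_slash]
  exact Filter.zero_zeroAtFilter _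

/-- A finite sum of functions vanishing at the cusp `c` vanishes at `c`. [cite: ShimuraIATAF1971, §2.1 (cusp forms)] -/
private theorem isZeroAt_sum {ι : Type*} (c : OnePoint ℝ) (k : ℤ) (s : Finset ι) (f : ι → ℍ → ℂ)
    (h : ∀ i ∈ s, c.IsZeroAt (f i) k) : c.IsZeroAt (∑ i ∈ s, f i) k := by
  classical
  induction s using Finset.induction_on with
  | empty => simpa only [Finset.sum_empty] using isZeroAt_zero c k
  | insert a s ha ih =>
    rw [Finset.sum_insert ha]
    exact (h a (Finset.mem_insert_self a s)).add (ih fun i hi => h i (Finset.mem_insert_of_mem hi))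

/-- **`T_n F` vanishes at every cusp of `Γ`** for `F ∈ S₂(Γ)` (finite coset space): `(F ∣[2] α)` vanishes at `c` iff `F` vanishes at the cusp
`α • c` (`isCusp_smul_of_mem_unitsHeckeSet`). Vacuous when `Γ` has no cusps (`D > 1`). [cite: ShimuraIATAF1971, Prop. 3.37 p. 76] -/
theorem isZeroAt_unitsHeckeFun (n : ℕ) [Fintype (Quotient (unitsHeckeSetoid ιB hO n))]
    (F : CuspForm (normOneUnits ιB hO) 2) {c : OnePoint ℝ} (hc : IsCusp c (normOneUnits ιB hO)) :
    c.IsZeroAt (unitsHeckeFun ιB hO n ⇑F) 2 := by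
  rw [unitsHeckeFun_eq_sum]
  refine isZeroAt_sum c 2 _ _ fun q _ => ?_
  exact OnePoint.IsZeroAt.smul_iff.mp
    (CuspFormClass.zero_at_cusps F (isCusp_smul_of_mem_unitsHeckeSet ιB hO n (q.out).2 hc))

/-- **A complete system of representatives indexed by a finite type makes `Γ∖ι(O(n))` finite** — the form in which a Hecke datum
supplies the finiteness hypothesis of this file (`∀ g ∈ ι(O(n)), ∃ i, ∃ u ∈ Γ, u * g = α i`, e.g. the representative clause of (LIFT′)).
[cite: ShimuraIATAF1971, Prop. 3.1 p. 51] -/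
theorem finite_quotient_unitsHeckeSetoid_of_cover (n : ℕ) {ι : Type*} [Finite ι] (α : ι → GL (Fin 2) ℝ)
    (hα : ∀ i, α i ∈ unitsHeckeSet ιB (O := O) n)
    (hcov : ∀ g ∈ unitsHeckeSet ιB (O := O) n, ∃ i, ∃ u ∈ normOneUnits ιB hO, u * g = α i) :
    Finite (Quotient (unitsHeckeSetoid ιB hO n)) := by
  refine Finite.of_surjective (fun i => Quotient.mk _ ⟨α i, hα i⟩) fun q => ?_
  induction q using Quotient.inductionOn with
  | h a =>
    obtain ⟨i, u, hu, hug⟩ := hcov a a.2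
    refine ⟨i, Quotient.sound ⟨u⁻¹, inv_mem hu, ?_⟩⟩
    change u⁻¹ * α i = (a : GL (Fin 2) ℝ)
    rw [← hug, inv_mul_cancel_left]

/-! ### 4. `T_n` on `S₂(Γ) = CuspForm (normOneUnits ι hO) 2` -/

/-- **`T_n` PRESERVES `S₂(ι(O¹))`** (Shimura Prop. 3.37 for the unit group of an arbitrary order, finite coset space): for `F ∈ S₂(Γ)` there is a
cusp form with underlying function `T_n F` — `Γ`-invariant (`unitsHeckeFun_slash_eq`), holomorphic (`mdifferentiable_unitsHeckeFun`), zero at the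
cusps (`isZeroAt_unitsHeckeFun`). [cite: ShimuraIATAF1971, Prop. 3.37 p. 76] -/
theorem exists_cuspForm_coe_eq_unitsHeckeFun (n : ℕ) [Finite (Quotient (unitsHeckeSetoid ιB hO n))]
    (F : CuspForm (normOneUnits ιB hO) 2) :
    ∃ T : CuspForm (normOneUnits ιB hO) 2, (⇑T : ℍ → ℂ) = unitsHeckeFun ιB hO n ⇑F := by
  classical
  letI : Fintype (Quotient (unitsHeckeSetoid ιB hO n)) := Fintype.ofFinite _
  exact ⟨{ toFun := unitsHeckeFun ιB hO n ⇑F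
           slash_action_eq' := fun _ hγ =>
             unitsHeckeFun_slash_eq ιB hO n hγ ⇑F fun δ hδ => SlashInvariantForm.slash_action_eqn F δ hδ
           holo' := mdifferentiable_unitsHeckeFun ιB hO n F.holo'
           zero_at_cusps' := fun hc => isZeroAt_unitsHeckeFun ιB hO n F hc }, rfl⟩

/-- **`T_n ∈ End_ℂ S₂(ι(O¹))`**: a `ℂ`-linear endomorphism `T` of `CuspForm (normOneUnits ι hO) 2` with `⇑(T F) = unitsHeckeFun ι hO n ⇑F` for every
`F` (existence form; unique by `linearMap_coe_eq_unitsHeckeFun_unique`). [cite: ShimuraIATAF1971, Prop. 3.37 p. 76 and §8.3 (8.3.4) p. 238] -/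
theorem exists_linearMap_coe_eq_unitsHeckeFun (n : ℕ) [Finite (Quotient (unitsHeckeSetoid ιB hO n))] :
    ∃ T : CuspForm (normOneUnits ιB hO) 2 →ₗ[ℂ] CuspForm (normOneUnits ιB hO) 2,
      ∀ F : CuspForm (normOneUnits ιB hO) 2, (⇑(T F) : ℍ → ℂ) = unitsHeckeFun ιB hO n ⇑F := by
  classical
  letI : Fintype (Quotient (unitsHeckeSetoid ιB hO n)) := Fintype.ofFinite _
  choose T hT using exists_cuspForm_coe_eq_unitsHeckeFun ιB hO n
  refine ⟨{ toFun := T, map_add' := fun F₁ F₂ => ?_, map_smul' := fun a F => ?_ }, hT⟩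
  · apply DFunLike.coe_injective
    rw [hT, CuspForm.coe_add, CuspForm.coe_add, hT, hT, unitsHeckeFun_add]
  · apply DFunLike.coe_injective
    rw [hT, RingHom.id_apply, CuspForm.IsGLPos.coe_smul, CuspForm.IsGLPos.coe_smul, hT, unitsHeckeFun_smul]

/-- Uniqueness of the endomorphism `T_n` of `S₂(ι(O¹))` with `⇑(T F) = unitsHeckeFun ι hO n ⇑F`. [cite: ShimuraIATAF1971, Prop. 3.37 p. 76] -/
theorem linearMap_coe_eq_unitsHeckeFun_unique (n : ℕ)
    {T T' : CuspForm (normOneUnits ιB hO) 2 →ₗ[ℂ] CuspForm (normOneUnits ιB hO) 2}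
    (hT : ∀ F : CuspForm (normOneUnits ιB hO) 2, (⇑(T F) : ℍ → ℂ) = unitsHeckeFun ιB hO n ⇑F)
    (hT' : ∀ F : CuspForm (normOneUnits ιB hO) 2, (⇑(T' F) : ℍ → ℂ) = unitsHeckeFun ιB hO n ⇑F) : T = T' :=
  LinearMap.ext fun F => DFunLike.coe_injective ((hT F).trans (hT' F).symm)

/-- **Eigen-identities of functions are eigen-identities in `S₂(ι(O¹))`**: if `T_n F = a · F` as functions then `T F = a • F` for the
endomorphism `T` inducing `T_n` (the form in which the hypotheses of `jacquetLanglands_cartanCover_newform` are read on the Hecke module).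
[cite: ShimuraIATAF1971, §8.3 (8.3.4) p. 238] -/
theorem linearMap_apply_eq_smul_of_unitsHeckeFun_eq (n : ℕ)
    {T : CuspForm (normOneUnits ιB hO) 2 →ₗ[ℂ] CuspForm (normOneUnits ιB hO) 2}
    (hT : ∀ F : CuspForm (normOneUnits ιB hO) 2, (⇑(T F) : ℍ → ℂ) = unitsHeckeFun ιB hO n ⇑F)
    {F : CuspForm (normOneUnits ιB hO) 2} {a : ℂ} (hF : unitsHeckeFun ιB hO n ⇑F = fun τ => a * F τ) :
    T F = a • F := by
  apply DFunLike.coe_injective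
  rw [hT, hF, CuspForm.IsGLPos.coe_smul]
  funext τ
  simp only [Pi.smul_apply, smul_eq_mul]

end UnitsHeckeCuspForm

/-! ### 5. (COMMᶜ) at the operator level: the endomorphisms `T_ℓ`, `T_ℓ'` of `S₂(coverUnits X q)` commute -/

section CoverCommutation

/-- **(COMMᶜ) for the endomorphisms**: granted the named fact `unitsHeckeFun_comm_cartanCover`, the `ℂ`-linear operators `T_ℓ`, `T_ℓ'`
of `S₂(Γ')` inducing `unitsHeckeFun X.ι hO' ℓ`, `unitsHeckeFun X.ι hO' ℓ'` (from `exists_linearMap_coe_eq_unitsHeckeFun`) commute, for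
primes `ℓ, ℓ' ∤ q·D·M·∏_C p` — the form consumed by Deligne–Serre lifting on the period lattice in the kernel of (LIFT′).
[cite: ShimuraIATAF1971, Prop. 3.8 p. 55 and Prop. 3.37 p. 76] -/
theorem linearMap_comm_of_unitsHeckeFun_comm_cartanCover (h : unitsHeckeFun_comm_cartanCover)
    {D M : ℕ} {C : Finset ℕ} (X : CartanLevelCurveData D M C) {q : ℕ} (hq : q ∈ C)
    (hO' : Brandt.IsOrder X.B (X.O ⊔ X.O₀.map ((((∏ p ∈ C.erase q, p : ℕ) : ℤ)) • LinearMap.id)))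
    {ℓ ℓ' : ℕ} (hℓ : ℓ.Prime) (hℓ' : ℓ'.Prime) (hℓN : ¬ ℓ ∣ q * (D * M * ∏ p ∈ C, p))
    (hℓ'N : ¬ ℓ' ∣ q * (D * M * ∏ p ∈ C, p))
    {T T' : CuspForm (normOneUnits X.ι hO') 2 →ₗ[ℂ] CuspForm (normOneUnits X.ι hO') 2}
    (hT : ∀ F : CuspForm (normOneUnits X.ι hO') 2, (⇑(T F) : ℍ → ℂ) = unitsHeckeFun X.ι hO' ℓ ⇑F)
    (hT' : ∀ F : CuspForm (normOneUnits X.ι hO') 2, (⇑(T' F) : ℍ → ℂ) = unitsHeckeFun X.ι hO' ℓ' ⇑F) :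
    T ∘ₗ T' = T' ∘ₗ T :=
  LinearMap.ext fun F => DFunLike.coe_injective (by
    rw [LinearMap.comp_apply, LinearMap.comp_apply, hT, hT', hT', hT]
    exact h D M C X q hq hO' F ℓ ℓ' hℓ hℓ' hℓN hℓ'N)

end CoverCommutation

end Literature.NumberTheory.Automorphic

end
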